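import Summits.ValiantsHypothesis.ValiantsHypothesis.Theorems.BarrierLeverChowBenchmarkPairsPeelGeneric

/-!
# Route BarrierLever — item 22038 `ChowBenchmarkPairs`, line `moore-peel`: inclusion-triangular determinants and the
# Vandermonde block of the peeling lemma at indicator points

Helper file (`--supports stmt-ValiantsHypothesis-22038`; cell valiant-natproofs, rung V4; seat val-np-p4 gen 21).  Closes NO item.

The peeling engine (`…Peel.lean`, `…PeelGeneric.lean`) has the hypothesis «the Vandermonde block
`[vand P i (U j ∖ A)]` (row `{new}` = the point `0`, rows `{a,new}` = the old points, monomials `z^{U_j ∖ A}`) is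
nonsingular».  In the symbolic iteration (old points generic, memo §0ter) this is discharged by ONE evaluation: at the
0/1 indicator points `P_a = 𝟙_{U_{some a} ∖ A}` the block is `[U_j∖A ⊆ U_i∖A]·|U_j∖A|!`, an INCLUSION-TRIANGULAR matrix.

* `det_subsetIndicator` — for an injective family of finite sets `D : ι → Finset κ` and weights `w`,
  `det [w j · [D j ⊆ D i]]_{i,j} = ∏_j w j` (block-triangular for the block map `i ↦ |D i|` into `ℕᵒᵈ`; the diagonal
  blocks — equal cardinalities — are diagonal by injectivity; `Matrix.BlockTriangular.det`).
* `det_vand_indicator` — with `U none = A`, `A ⊆ U j` and `U` injective, the Vandermonde block of `…Peel.lean` at the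
  indicator table is `∏_j |U j ∖ A|!`, hence nonzero in characteristic zero (`det_vand_indicator_ne_zero`).

WHAT THIS IS NOT: no stub of the line is closed; nothing on crux stmt-ValiantsHypothesis-14610 or on `VP` versus `VNP`.
-/

set_option linter.dupNamespace false

namespace Summit.ValiantsHypothesis.ValiantsHypothesis.Theorems.BarrierLever.ChowBenchmarkPeel

open Finset

variable {κ : Type*} [DecidableEq κ]

/-! ## 1. Inclusion-triangular determinants -/

section Triangular

variable {R : Type*} [CommRing R] {ι : Type*} [Fintype ι] [DecidableEq ι]

/-- **Inclusion-triangular determinant.**  For an injective family of finite sets `D` and weights `w`: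
`det [ [D j ⊆ D i] · w j ] = ∏_j w j`. -/
theorem det_subsetIndicator (D : ι → Finset κ) (hD : Function.Injective D) (w : ι → R) :
    (Matrix.of fun i j : ι => if D j ⊆ D i then w j else 0).det = ∏ j, w j := by
  classical
  set M : Matrix ι ι R := Matrix.of fun i j : ι => if D j ⊆ D i then w j else 0 with hM
  -- block map: cardinality, read in the order dual
  let b : ι → ℕᵒᵈ := fun i => OrderDual.toDual (D i).card
  have hbt : M.BlockTriangular b := by
    intro i j hij
    -- hij : b j < b i, i.e. card (D i) < card (D j)
    have hlt : (D i).card < (D j).card := OrderDual.toDual_lt_toDual.mp hij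
    rw [hM, Matrix.of_apply, if_neg]
    exact fun hsub => Nat.lt_irrefl _ (lt_of_le_of_lt (Finset.card_le_card hsub) hlt)
  rw [hbt.det]
  -- each diagonal block is diagonal with entries `w`
  have hblock : ∀ a : ℕᵒᵈ, (M.toSquareBlock b a).det = ∏ j : {i // b i = a}, w j := by
    intro a
    have : M.toSquareBlock b a = Matrix.diagonal fun j : {i // b i = a} => w j := by
      ext ⟨i, hi⟩ ⟨j, hj⟩
      rw [Matrix.toSquareBlock_def, Matrix.of_apply, hM, Matrix.of_apply, Matrix.diagonal_apply]
      by_cases hij : i = j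
      · subst hij
        rw [if_pos (Finset.Subset.refl _), if_pos rfl]
      · have hcard : (D i).card = (D j).card := by
          have h1 : b i = b j := hi.trans hj.symm
          exact OrderDual.toDual.injective h1
        rw [if_neg, if_neg (fun e => hij (Subtype.ext_iff.mp e))]
        intro hsub
        exact hij (hD (Finset.eq_of_subset_of_card_le hsub hcard.le).symm)
    rw [this, Matrix.det_diagonal]
  simp_rw [hblock]
  -- reassemble the product over the fibres of `b`
  have key : ∀ a : ℕᵒᵈ, (∏ j : {i // b i = a}, w j) = ∏ i ∈ Finset.univ.filter (fun i => b i = a), w i := by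
    intro a
    rw [← Finset.prod_subtype (Finset.univ.filter fun i => b i = a) (by simp)]
  rw [Finset.prod_congr rfl fun a _ => key a]
  exact Finset.prod_fiberwise_of_maps_to (fun i _ => Finset.mem_image_of_mem b (Finset.mem_univ i)) w

end Triangular

/-! ## 2. The Vandermonde block at indicator points -/

section VandIndicator

variable {n : ℕ}

/-- The indicator table of the family `U ∖ A`: `P a c = [c ∈ U (some a) ∖ A]`. -/
def indTable (U : Option (Fin n) → Finset κ) (A : Finset κ) : Fin n → κ → ℂ :=
  fun a c => if c ∈ U (some a) \ A then 1 else 0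

/-- At the indicator table the Vandermonde block is inclusion-triangular:
`vand (indTable U A) i (U j ∖ A) = [U j ∖ A ⊆ U i ∖ A] · |U j ∖ A|!` (for `U none = A`). -/
theorem vand_indTable (U : Option (Fin n) → Finset κ) (A : Finset κ) (hU0 : U none = A) (i j : Option (Fin n)) :
    vand (indTable U A) i (U j \ A) =
      if U j \ A ⊆ U i \ A then (((U j \ A).card.factorial : ℕ) : ℂ) else 0 := by
  cases i with
  | none =>
    rw [vand, hU0, Finset.sdiff_self]
    by_cases h : U j \ A = ∅
    · rw [if_pos h, if_pos (Finset.subset_empty.mpr h), h, Finset.card_empty, Nat.factorial_zero, Nat.cast_one]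
    · rw [if_neg h, if_neg (fun h' => h (Finset.subset_empty.mp h'))]
  | some a =>
    rw [vand]
    unfold indTable
    rw [Finset.prod_boole]
    by_cases h : U j \ A ⊆ U (some a) \ A
    · rw [if_pos h, if_pos (fun c hc => h hc), mul_one]
    · rw [if_neg h, if_neg (fun h' => h (fun c hc => h' c hc)), mul_zero]

/-- **The Vandermonde block of the peeling lemma at the indicator table is `∏_j |U j ∖ A|!`.** -/
theorem det_vand_indTable (U : Option (Fin n) → Finset κ) (A : Finset κ) (hU0 : U none = A)
    (hUA : ∀ j, A ⊆ U j) (hU : Function.Injective U) :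
    (Matrix.of fun i j : Option (Fin n) => vand (indTable U A) i (U j \ A)).det =
      ∏ j : Option (Fin n), (((U j \ A).card.factorial : ℕ) : ℂ) := by
  have hD : Function.Injective (fun j : Option (Fin n) => U j \ A) := by
    intro j j' e
    apply hU
    have := congrArg (fun S => S ∪ A) e
    simp only [Finset.sdiff_union_of_subset (hUA j), Finset.sdiff_union_of_subset (hUA j')] at this
    exact this
  rw [← det_subsetIndicator (fun j : Option (Fin n) => U j \ A) hD
    (fun j => (((U j \ A).card.factorial : ℕ) : ℂ))]
  congr 1
  ext i j
  rw [Matrix.of_apply, Matrix.of_apply, vand_indTable U A hU0]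

/-- Hence the Vandermonde hypothesis of `rigid_extension` holds at the indicator table (characteristic zero). -/
theorem det_vand_indTable_ne_zero (U : Option (Fin n) → Finset κ) (A : Finset κ) (hU0 : U none = A)
    (hUA : ∀ j, A ⊆ U j) (hU : Function.Injective U) :
    (Matrix.of fun i j : Option (Fin n) => vand (indTable U A) i (U j \ A)).det ≠ 0 := by
  rw [det_vand_indTable U A hU0 hUA hU, Finset.prod_ne_zero_iff]
  intro j _
  exact Nat.cast_ne_zero.mpr (Nat.factorial_ne_zero _)

end VandIndicator

end Summit.ValiantsHypothesis.ValiantsHypothesis.Theorems.BarrierLever.ChowBenchmarkPeel
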